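/-
Origin: expansion seat `planner-pub-hodgecm-mc-period-1-g10-0`, handover #1101 2026-08-19T21:27Z md5 fb24bcdfe0c126419996d18a8300f828 (r5b = r4 ce8701355c21 + §E six η-continuity lemmas (`toAdeleGL` qualified) = r3c + import ArchSideLevel + pin fields fin_mem_Gfin/rat_split_level; THE S PIN TERM archSideOf V c … : ThetaAdelicSide V c over theta-3's RUN-38 re-cut; rides the same run as that pin re-cut; replaces #1099 r3c if installed at RUN 37 else new; drop alone on bounce) (`HOME/mc/pub-hodgecm-mc-period-1-g10/stage/HodgeCM/Model/ArchSideOf.lean`, md5 fb24bcdfe0c1, 404 lines);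
landed by the second packager (p2) in gate run 38 REPLACES the earlier landed copy of `HodgeCM/Model/ArchSideOf.lean` (stripped 2 trailing import-line comments).
-/
/-
HodgeCM/Model/ArchSideOf.lean — period-1 lane, the S pin TERM of (S-restr): `archSideOf V c : ThetaAdelicSide V c` with
`((archSideOf V c …).P k).ω = lineRepOf V c.D … k` ON THE NOSE (LAYER B `HodgeCM/Model/ArchSideTerm.lean`, (J5)), the DEFAULT
η-split `η₀ := cmEta₀ η`, `η₁ := cmEta₁ η ∘ snd`, `η₂ := cmConjEta₀ η`, `η₃ := cmConjEta₁ η ∘ snd` (model1 (A3)(b); tree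
`cmEta_torus` / `cmConjEta_torus` discharge LAYER B's splitting binders `hη01` / `hη23`), `ΓU := (V.latticeModel hP).Γ` (`hΓU k := rfl`),
the archimedean component / away-factor / commutation / rational splitting from #1097 `HodgeCM/Model/ArchSideInstance.lean`
(`archInfOf`, `archFinOf`, `commute_archFinOf_archInfOf`, `rat_split_archInfOf`), their FINITE-LEVEL companions (theta-3's RUN-38
pin fields (L3b) `fin_mem_Gfin` / (L3) `rat_split_level`) from `HodgeCM/Model/ArchSideLevel.lean` (`inv_finAdelic_mem_archFinOf`,
`rat_split_level_archInfOf`, over the tree's `UnitaryGroupAwayLevel`), and the two Weil hypotheses of each line PROVED: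
`majorants` = tree `hasThetaMajorants_cmLineRepFin₀/₁_framed_of_signs`, `hasThetaMajorants_cmConjLineRepFin₀/₁_framed_of_signs`
[Weil1964 III n°41 Thm 6 p. 193, via discharge-4 `…SeesawCMLinesMajorants` / `…ConjMajorants` / `…Framed`], the sign facts READ OFF
`HermSpace3` (`frameD_sign_ι₁'`, `frameD_sign_of_ne`, unitary-1 `WmInstanceV2`) plus ONE binder `h₁W` (the plane `diag(a₀,a₁)` is definite
at `ι₁`; glue-1 reads it off `GoodCtx.forced`, exactly as for the W pin's `wmInputCM₂s'`); `theta_rat` = tree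
`forall_cm(Conj)LineRepFin₀/₁_framed_mem_thetaStabilizerEnd` [GelbartRogawski1991 §3.1 Remark p. 457] from the W pin's OWN binder `hη`
(`cmEta₀_eq_one_of_rat` & co., discharge-4 `…SeesawCMLinesRational`) and `mem_regimeRat_iff`.

REMAINING INPUT (not period-1's to construct; theta-3 / ArchKType content, (W-wt)): per line `k` the archimedean test datum
`A k : ArchLineInput V (lineRepOf … k)` = `(Φinf, x₀, hx₀, w, weight)` — the five archimedean fields of `WeilPairData`, stated for
`ω := lineRepOf … k`.  Everything else of `ThetaAdelicSide V c` is constructed here.  Binders of `archSideOf`, all told: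
the W pin's `hGR η hη hηc` (unitary-1 `WmInstanceV2` §V2, verbatim types), the four small-pair splittings `hGR₀ … hGR₃`
[GR91 Prop. 3.1.1 p. 455, the same published theorem as `hGR` at rank 3 × 1], `h₁W`, and `A`.

STATUS (r4, 2026-08-19T20:30Z, period-1-g10 = r3 e9886faa2c9a of period-1-g9 + `import HodgeCM.Model.ArchSideLevel` + the two
RUN-38 pin fields `fin_mem_Gfin := inv_finAdelic_mem_archFinOf V`, `rat_split_level := rat_split_level_archInfOf V` of theta-3's
`ThetaAdelicSide` re-cut, §F's `regimeEquiv_prodSymm_one_mem_archFinOf` now the one-liner `finAdelic_mem_archFinOf`; r2 = r1 + §F,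
theta-3 (L3b) at the honest term; r3 = r2 + `archInfOf_eq_regimeEquiv` / `archSideOf_ιinf_apply`, binder-1 D-1′ `hι` at the honest term):
RUN-38 leaf REPLACING the RUN-37 row r3 (installs after LAYER B `HodgeCM/Model/ArchSideTerm.lean`, `HodgeCM/Model/ArchSideLevel.lean`,
theta-3's RUN-38 `HodgeCM/Model/ThetaSpaceInputPin.lean` re-cut over glue-1's (W1) `CM/Basic`, and the
K-1 twins of discharge-4's tree files `UnitaryDualPairSeesaw{ConjMajorants,SmallMajorants,CMLinesMajorants,CMLinesConjMajorants,
CMLinesRational,CMLinesFramed}.lean` and of `Automorphic/UnitaryGroupAwayLevel.lean`); COMPILED privately in a RUN-38 PREVIEW world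
(PKG RUN-35 oleans + the RUN-36 cone modules of LAYER B + private `HodgeCM.Vendored.H21` twins of those seven tree files + `ArchSideLevel`
+ a private copy of theta-3's pin re-cut 68c7c57560c1 §§1–2 with the (W1) abbrev `HermSpace3.adelicFin` reproduced verbatim, all built
with the RUN-36 row-#0 name entries; this file's bytes carry no such line): rc 0, 0 errors, 0 warnings, no placeholders; the
foundational-dependency census of all 25 declarations is {propext, Classical.choice, Quot.sound}.  No records other than the input bundle `ArchLineInput` (five data/proof
fields copied from `WeilPairData`, no hypothesis of its own), no cited facts, no E-binder.

§E (r5b / r3c, 2026-08-19T21:27Z, period-1-g10; = r5 / r3b with `toAdeleGL` written `Literature.NumberTheory.Automorphic.toAdeleGL` —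
package-side the bare name is ambiguous with `HodgeCM.Adelic.toAdeleGL`, binder-1-g9 BUILD FINDING 21:24:12Z): the six continuity lemmas of the DEFAULT η-split `continuous_cmPlaneTorus`,
`continuous_cmConjPlaneTorus`, `continuous_cmEta₀`, `continuous_cmEta₁_comp_snd`, `continuous_cmConjEta₀`, `continuous_cmConjEta₁_comp_snd`
— formerly §3 of discharge-4's tree file `UnitaryDualPairSeesawCMLinesFramed.lean` r2, removed there at its r3 under the gate's citation
lint (`Literature/` holds only cited published statements; our own helper lemmas live package-side, with their consumer) — now live HERE,
namespace `HodgeCM.Model`, statements and proofs verbatim (binder renamed `L ↦ F`); §W's four uses of them are byte-unchanged.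

Origin: Hodge-CM model-construction cell, row `S` of BINDER-OWNERS (period-1), booking (ii) (S-restr); mathematics =
[Howe1979 §3; Kudla1984 §1; GelbartRogawski1991 §3.1 pp. 455/457; Weil1964 III n°41] as reproduced in the tree files.
-/
import Summits.HodgeConjecture.HodgeCM.Model.ArchSideTerm
import Summits.HodgeConjecture.HodgeCM.Model.ArchSideLevel
import Literature.NumberTheory.GelbartRogawski1991.UnitaryDualPairSeesawCMLinesFramed

-- G11b-3 recipe (port D30 slow-export class; ops-buildfix LEDGER B13-1/B13-3): elaborate sequentially so the trailing
-- `attribute [implicit_reducible]` block (reducibilityCoreExt is keyed to the async environment branch) is in force at `.olean` export.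
set_option Elab.async false

set_option autoImplicit false

noncomputable section

open scoped Matrix SchwartzMap
open NumberField NumberField.mixedEmbedding
open Literature.NumberTheory.Automorphic Literature.NumberTheory.Weil1964
open Literature.NumberTheory.GelbartRogawski1991.UnitaryDualPair
open HodgeCM.Adelic HodgeCM.PerL34
open Literature.Geometry.ComplexHyperbolic.BallModel (U21)

namespace HodgeCM.Model

/-! ## §E Continuity of the DEFAULT η-split (the hypothesis `Continuous ↑η_k` of the tree's `…_framed_of_signs`, from the W-block's
`Continuous ↑η`) — formerly §3 of the tree file `UnitaryDualPairSeesawCMLinesFramed.lean` r2 (discharge-4), package-side since its r3 -/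

section EtaContinuity

open Literature.NumberTheory.Automorphic.UnitaryGroup

variable (F : Type) [Field F] [NumberField F] [IsCMField F] {N : ℕ} (dV : Fin N → F) (a b : Fin 2 → F) (g₀ : GL (Fin 2) F)
  (hg₀ : ((g₀ : Matrix (Fin 2) (Fin 2) F).map (IsCMField.complexConj F : F →+* F))ᵀ * Matrix.diagonal a *
    (g₀ : Matrix (Fin 2) (Fin 2) F) = Matrix.diagonal b)

/-- the plane's diagonal torus `(u₀, u₁) ↦ diag(u₀, u₁)` is continuous (centres, block-diagonal and conjugation by `1` are). -/
theorem continuous_cmPlaneTorus : Continuous (cmPlaneTorus F a) :=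
  (continuous_adelicIsometryConj (↥(maximalRealSubfield F)) F (IsCMField.complexConj F) (1 + 1) 1
      (adelicIsometry_one_lineVec F a)).comp
    ((continuous_adelicBlockDiag (↥(maximalRealSubfield F)) F (IsCMField.complexConj F) 1 1
        (Matrix.diagonal (lineVec F (a 0))) (Matrix.diagonal (lineVec F (a 1)))).comp
      ((continuous_adelicCenter (↥(maximalRealSubfield F)) F (IsCMField.complexConj F) 1 (Matrix.diagonal (lineVec F (a 0)))).prodMap
        (continuous_adelicCenter (↥(maximalRealSubfield F)) F (IsCMField.complexConj F) 1 (Matrix.diagonal (lineVec F (a 1))))))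

/-- the conjugated torus `(u₀, u₁) ↦ g₀ · diag(u₀, u₁) · g₀⁻¹` is continuous. -/
theorem continuous_cmConjPlaneTorus : Continuous (cmConjPlaneTorus F a b g₀ hg₀) :=
  (continuous_adelicIsometryConj (↥(maximalRealSubfield F)) F (IsCMField.complexConj F) (1 + 1) (Literature.NumberTheory.Automorphic.toAdeleGL F g₀)
      (adelicIsometry_conj F a b g₀ hg₀)).comp
    ((continuous_adelicBlockDiag (↥(maximalRealSubfield F)) F (IsCMField.complexConj F) 1 1
        (Matrix.diagonal (lineVec F (b 0))) (Matrix.diagonal (lineVec F (b 1)))).comp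
      ((continuous_adelicCenter (↥(maximalRealSubfield F)) F (IsCMField.complexConj F) 1 (Matrix.diagonal (lineVec F (b 0)))).prodMap
        (continuous_adelicCenter (↥(maximalRealSubfield F)) F (IsCMField.complexConj F) 1 (Matrix.diagonal (lineVec F (b 1))))))

variable (η : CMAdelic F dV × CMAdelic F a →* ℂˣ) (hηc : Continuous fun p => ((η p : ℂˣ) : ℂ))

include hηc in
/-- **`η₀ := cmEta₀ η` has continuous values** when `η` has (the W-block's binder `hηc`). -/
theorem continuous_cmEta₀ : Continuous fun p => ((cmEta₀ F dV a η p : ℂˣ) : ℂ) :=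
  hηc.comp (continuous_fst.prodMk (((continuous_cmPlaneTorus F a).comp (continuous_id.prodMk continuous_const)).comp continuous_snd))

include hηc in
/-- **`η₁ := cmEta₁ η ∘ snd` has continuous values** when `η` has. -/
theorem continuous_cmEta₁_comp_snd :
    Continuous fun p : CMAdelic F dV × CMAdelicOne F => (((cmEta₁ F dV a η).comp (MonoidHom.snd _ _) p : ℂˣ) : ℂ) :=
  hηc.comp (continuous_const.prodMk (((continuous_cmPlaneTorus F a).comp (continuous_const.prodMk continuous_id)).comp continuous_snd))

include hηc in
/-- **`η₂ := cmConjEta₀ η` has continuous values** when `η` has. -/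
theorem continuous_cmConjEta₀ : Continuous fun p => ((cmConjEta₀ F dV a b g₀ hg₀ η p : ℂˣ) : ℂ) :=
  hηc.comp (continuous_fst.prodMk
    (((continuous_cmConjPlaneTorus F a b g₀ hg₀).comp (continuous_id.prodMk continuous_const)).comp continuous_snd))

include hηc in
/-- **`η₃ := cmConjEta₁ η ∘ snd` has continuous values** when `η` has. -/
theorem continuous_cmConjEta₁_comp_snd :
    Continuous fun p : CMAdelic F dV × CMAdelicOne F => (((cmConjEta₁ F dV a b g₀ hg₀ η).comp (MonoidHom.snd _ _) p : ℂˣ) : ℂ) :=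
  hηc.comp (continuous_const.prodMk
    (((continuous_cmConjPlaneTorus F a b g₀ hg₀).comp (continuous_const.prodMk continuous_id)).comp continuous_snd))

end EtaContinuity

namespace ArchSideTerm

variable {L : CMField} {ι₁ : L →+* ℂ} (V : HermSpace3 L ι₁) (S : StubTree.SeesawDatum L)

/-! ## §A The archimedean input of one line (the (W-wt) fields of `WeilPairData`, for a GIVEN `ω`) -/

open scoped Classical in
/-- **archimedean test datum of one line**: the five archimedean fields `Φinf, x₀, hx₀, w, weight` of
`SupplyResidual.WeilPairData`, the weight identity being stated for the given line representation `ω`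
(`= lineRepOf … k` in `archSideOf`).  Pure input bundle — no hypothesis beyond `WeilPairData`'s own fields.
(`Classical` is opened for the `Fintype` of the real/complex places inside `mixedSpace`, as in `SupplyResidual`.) -/
structure ArchLineInput
    (ω : Representation ℂ (↥(regimeSubgroup L V.Hm) × ↥(NumberField.relNormOneIdeles (↥(maximalRealSubfield L)) L))
      (piSchwartzBruhat (↥(maximalRealSubfield L)) (Fin 3))) where
  /-- the archimedean test function `φ_∞` -/
  Φinf : 𝓢(((Fin 3) → mixedSpace (↥(maximalRealSubfield L))), ℂ)
  /-- the rational base point `x₀` -/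
  x₀ : Fin 3 → ↥(maximalRealSubfield L)
  /-- `φ_∞(x₀) ≠ 0` -/
  hx₀ : Φinf (SupplyInstance.archEmb (↥(maximalRealSubfield L)) (Fin 3) x₀) ≠ 0
  /-- the archimedean weight `w` -/
  w : ↥(Literature.NumberTheory.Automorphic.relNormOneInfUnits (↥(maximalRealSubfield L)) L) → ℂ
  /-- (W-wt) `φ_N` is a weight-`w` vector of the archimedean torus under `ω` -/
  weight : ∀ (N : ℕ) (t : ↥(Literature.NumberTheory.Automorphic.relNormOneInfUnits (↥(maximalRealSubfield L)) L)),
    ω (1, Literature.NumberTheory.Automorphic.relNormOneInfToIdeles (↥(maximalRealSubfield L)) L t)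
        (SupplyInstance.testFun (↥(maximalRealSubfield L)) (Fin 3) Φinf x₀ N) =
      w t • SupplyInstance.testFun (↥(maximalRealSubfield L)) (Fin 3) Φinf x₀ N

/-! ## §D The default η-split and its two splitting identities -/

section Split

variable (η : CMAdelic (L : Type) (frameD V) × CMAdelic (L : Type) (dW S) →* ℂˣ)

/-- `η₀ := cmEta₀ η` — `η₀(v,u) = η(v, diag(u,1))`. -/
def eta₀ : CMAdelic (L : Type) (frameD V) × CMAdelicOne (L : Type) →* ℂˣ := cmEta₀ (L : Type) (frameD V) (dW S) η

/-- `η₁ := cmEta₁ η ∘ snd` — `η₁(v,u) = η(1, diag(1,u))`. -/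
def eta₁ : CMAdelic (L : Type) (frameD V) × CMAdelicOne (L : Type) →* ℂˣ :=
  (cmEta₁ (L : Type) (frameD V) (dW S) η).comp (MonoidHom.snd _ _)

/-- `η₂ := cmConjEta₀ η` — `η₂(v,u) = η(v, isoGL·diag(u,1)·isoGL⁻¹)`. -/
def eta₂ : CMAdelic (L : Type) (frameD V) × CMAdelicOne (L : Type) →* ℂˣ :=
  cmConjEta₀ (L : Type) (frameD V) (dW S) (dW' S) S.isoGL (isoGL_hg₀ S) η

/-- `η₃ := cmConjEta₁ η ∘ snd` — `η₃(v,u) = η(1, isoGL·diag(1,u)·isoGL⁻¹)`. -/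
def eta₃ : CMAdelic (L : Type) (frameD V) × CMAdelicOne (L : Type) →* ℂˣ :=
  (cmConjEta₁ (L : Type) (frameD V) (dW S) (dW' S) S.isoGL (isoGL_hg₀ S) η).comp (MonoidHom.snd _ _)

/-- LAYER B's `hη01` for the default split (tree `cmEta_torus`). -/
theorem eta_torus01 (v : CMAdelic (L : Type) (frameD V)) (u₀ u₁ : CMAdelicOne (L : Type)) :
    η (v, cmPlaneTorus (L : Type) (dW S) (u₀, u₁)) = eta₀ V S η (v, u₀) * eta₁ V S η (v, u₁) :=
  cmEta_torus (L : Type) (frameD V) (dW S) η v u₀ u₁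

/-- LAYER B's `hη23` for the default split (tree `cmConjEta_torus`). -/
theorem eta_torus23 (v : CMAdelic (L : Type) (frameD V)) (u₀ u₁ : CMAdelicOne (L : Type)) :
    η (v, cmConjPlaneTorus (L : Type) (dW S) (dW' S) S.isoGL (isoGL_hg₀ S) (u₀, u₁)) = eta₂ V S η (v, u₀) * eta₃ V S η (v, u₁) :=
  cmConjEta_torus (L : Type) (frameD V) (dW S) (dW' S) S.isoGL (isoGL_hg₀ S) η v u₀ u₁

end Split

/-! ## §W The two Weil hypotheses of the four line representations, PROVED -/

section Weil

variable
  (hGR : (cmSplittingDatum (L : Type) finProdFinEquiv (frameD V) (frameD_real V) (frameD_ne V) (dW S) (dW_real S) (dW_ne S)).CompatibleSplitting)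
  (hGR₀ : (cmSplittingDatum (L : Type) (e₁) (frameD V) (frameD_real V) (frameD_ne V) (lineVec (L : Type) (dW S 0))
    (fun _ => dW_real S 0) (fun _ => dW_ne S 0)).CompatibleSplitting)
  (hGR₁ : (cmSplittingDatum (L : Type) (e₁) (frameD V) (frameD_real V) (frameD_ne V) (lineVec (L : Type) (dW S 1))
    (fun _ => dW_real S 1) (fun _ => dW_ne S 1)).CompatibleSplitting)
  (hGR₂ : (cmSplittingDatum (L : Type) (e₁) (frameD V) (frameD_real V) (frameD_ne V) (lineVec (L : Type) (dW' S 0))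
    (fun _ => dW'_real S 0) (fun _ => dW'_ne S 0)).CompatibleSplitting)
  (hGR₃ : (cmSplittingDatum (L : Type) (e₁) (frameD V) (frameD_real V) (frameD_ne V) (lineVec (L : Type) (dW' S 1))
    (fun _ => dW'_real S 1) (fun _ => dW'_ne S 1)).CompatibleSplitting)
  (η : CMAdelic (L : Type) (frameD V) × CMAdelic (L : Type) (dW S) →* ℂˣ)

/-- the S-side line representation of line `k` with the DEFAULT η-split (reducible wrapper of LAYER B's `lineRepOf`). -/
abbrev lineRepD (k : Fin 4) :
    Representation ℂ (↥(regimeSubgroup L V.Hm) × ↥(NumberField.relNormOneIdeles (↥(maximalRealSubfield L)) L))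
      (piSchwartzBruhat (↥(maximalRealSubfield L)) (Fin 3)) :=
  lineRepOf V S hGR hGR₀ hGR₁ hGR₂ hGR₃ (eta₀ V S η) (eta₁ V S η) (eta₂ V S η) (eta₃ V S η) k

/-- **(W-maj⁺) PROVED for the four lines** [Weil1964 III n°41 Thm 6 p. 193]: theta majorants of `lineRepD k`, from the framed
pair majorants of the tree, the sign facts of `HermSpace3` read on the rational frame, the definiteness `h₁W` of the plane at `ι₁`,
and the continuity of `η` (the W pin's `hηc`). -/
theorem hasThetaMajorants_lineRepD (hηc : Continuous fun p => ((η p : ℂˣ) : ℂ))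
    (h₁W : (∀ j, 0 < (ι₁ (dW S j)).re) ∨ ∀ j, (ι₁ (dW S j)).re < 0) (k : Fin 4) :
    HasThetaMajorants fun (p : ↥(regimeSubgroup L V.Hm) × ↥(NumberField.relNormOneIdeles (↥(maximalRealSubfield L)) L))
      (φ : piSchwartzBruhat (↥(maximalRealSubfield L)) (Fin 3)) => lineRepD V S hGR hGR₀ hGR₁ hGR₂ hGR₃ η k p φ := by
  fin_cases k
  · exact hasThetaMajorants_cmLineRepFin₀_framed_of_signs (L : Type) finProdFinEquiv e₁ (frameD V) (frameD_real V) (frameD_ne V)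
      (dW S) (dW_real S) (dW_ne S) hGR hGR₀ hGR₁ (eta₀ V S η) (frame_congr V) (regimeSubgroup L V.Hm) ι₁ (frameD_sign_ι₁' V) h₁W
      (frameD_sign_of_ne V) (continuous_cmEta₀ (L : Type) (frameD V) (dW S) η hηc)
  · exact hasThetaMajorants_cmLineRepFin₁_framed_of_signs (L : Type) finProdFinEquiv e₁ (frameD V) (frameD_real V) (frameD_ne V)
      (dW S) (dW_real S) (dW_ne S) hGR hGR₀ hGR₁ (eta₁ V S η) (frame_congr V) (regimeSubgroup L V.Hm) ι₁ (frameD_sign_ι₁' V) h₁W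
      (frameD_sign_of_ne V) (continuous_cmEta₁_comp_snd (L : Type) (frameD V) (dW S) η hηc)
  · exact hasThetaMajorants_cmConjLineRepFin₀_framed_of_signs (L : Type) finProdFinEquiv e₁ (frameD V) (frameD_real V) (frameD_ne V)
      (dW S) (dW_real S) (dW_ne S) (dW' S) (dW'_real S) (dW'_ne S) S.isoGL (isoGL_hg₀ S) hGR hGR₂ hGR₃ (eta₂ V S η) (frame_congr V)
      (regimeSubgroup L V.Hm) ι₁ (frameD_sign_ι₁' V) h₁W (frameD_sign_of_ne V)
      (continuous_cmConjEta₀ (L : Type) (frameD V) (dW S) (dW' S) S.isoGL (isoGL_hg₀ S) η hηc)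
  · exact hasThetaMajorants_cmConjLineRepFin₁_framed_of_signs (L : Type) finProdFinEquiv e₁ (frameD V) (frameD_real V) (frameD_ne V)
      (dW S) (dW_real S) (dW_ne S) (dW' S) (dW'_real S) (dW'_ne S) S.isoGL (isoGL_hg₀ S) hGR hGR₂ hGR₃ (eta₃ V S η) (frame_congr V)
      (regimeSubgroup L V.Hm) ι₁ (frameD_sign_ι₁' V) h₁W (frameD_sign_of_ne V)
      (continuous_cmConjEta₁_comp_snd (L : Type) (frameD V) (dW S) (dW' S) S.isoGL (isoGL_hg₀ S) η hηc)

/-- **(W-rat⁺) PROVED for the four lines** [GelbartRogawski1991 §3.1 Remark p. 457 L4–13]: `lineRepD k (γ, t)` stabilises `Θ` for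
`γ ∈ Γ = regimeRat` and `t ∈ U(1)(L⁺)`, from the W pin's OWN rationality binder `hη` (`η = 1` on rational points). -/
theorem lineRepD_mem_thetaStabilizerEnd (hη : ∀ γU ∈ CMRat (L : Type) (frameD V), ∀ γ ∈ CMRat (L : Type) (dW S), η (γU, γ) = 1)
    (k : Fin 4) :
    ∀ γ ∈ (V.latticeModel printFact_unitaryCompact_holds).Γ, ∀ t ∈ NumberField.relNormOneRat (↥(maximalRealSubfield L)) L,
      lineRepD V S hGR hGR₀ hGR₁ hGR₂ hGR₃ η k (γ, t) ∈ thetaStabilizerEnd (↥(maximalRealSubfield L)) (Fin 3) := by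
  fin_cases k
  · exact forall_cmLineRepFin₀_framed_mem_thetaStabilizerEnd (L : Type) finProdFinEquiv e₁ (frameD V) (frameD_real V) (frameD_ne V)
      (dW S) (dW_real S) (dW_ne S) hGR hGR₀ hGR₁ (eta₀ V S η) (frame_congr V) (regimeSubgroup L V.Hm)
      (V.latticeModel printFact_unitaryCompact_holds).Γ (fun γ hγ => (mem_regimeRat_iff γ).1 hγ)
      (fun v hv t ht => cmEta₀_eq_one_of_rat (L : Type) (frameD V) (dW S) η hη hv ht)
  · exact forall_cmLineRepFin₁_framed_mem_thetaStabilizerEnd (L : Type) finProdFinEquiv e₁ (frameD V) (frameD_real V) (frameD_ne V)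
      (dW S) (dW_real S) (dW_ne S) hGR hGR₀ hGR₁ (eta₁ V S η) (frame_congr V) (regimeSubgroup L V.Hm)
      (V.latticeModel printFact_unitaryCompact_holds).Γ (fun γ hγ => (mem_regimeRat_iff γ).1 hγ)
      (fun v hv t ht => cmEta₁_eq_one_of_rat (L : Type) (frameD V) (dW S) η hη ht)
  · exact forall_cmConjLineRepFin₀_framed_mem_thetaStabilizerEnd (L : Type) finProdFinEquiv e₁ (frameD V) (frameD_real V) (frameD_ne V)
      (dW S) (dW_real S) (dW_ne S) (dW' S) (dW'_real S) (dW'_ne S) S.isoGL (isoGL_hg₀ S) hGR hGR₂ hGR₃ (eta₂ V S η) (frame_congr V)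
      (regimeSubgroup L V.Hm) (V.latticeModel printFact_unitaryCompact_holds).Γ (fun γ hγ => (mem_regimeRat_iff γ).1 hγ)
      (fun v hv t ht => cmConjEta₀_eq_one_of_rat (L : Type) (frameD V) (dW S) (dW' S) S.isoGL (isoGL_hg₀ S) η hη hv ht)
  · exact forall_cmConjLineRepFin₁_framed_mem_thetaStabilizerEnd (L : Type) finProdFinEquiv e₁ (frameD V) (frameD_real V) (frameD_ne V)
      (dW S) (dW_real S) (dW_ne S) (dW' S) (dW'_real S) (dW'_ne S) S.isoGL (isoGL_hg₀ S) hGR hGR₂ hGR₃ (eta₃ V S η) (frame_congr V)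
      (regimeSubgroup L V.Hm) (V.latticeModel printFact_unitaryCompact_holds).Γ (fun γ hγ => (mem_regimeRat_iff γ).1 hγ)
      (fun v hv t ht => cmConjEta₁_eq_one_of_rat (L : Type) (frameD V) (dW S) (dW' S) S.isoGL (isoGL_hg₀ S) η hη ht)

end Weil

/-! ## §F Finite-adelic translates lie in the away-factor (theta-3 (L3b) `fin_mem_Gfin`, for the honest `Gfin`) -/

section Fin

/-- **`e⁻¹(1, k_f) ∈ Gfin` for the CONSTRUCTED away-factor `archFinOf V`** (in the regime): the adelic point with
archimedean component `1` and finite component `k_f` is away from the place of `ι₁` (tree `finAdelicToAdelic_mem_awayFrom`,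
`adelicProdEquiv_symm_apply` [BorelJacquet1979 §4.1]), and `toLatticeModelG V = regimeEquiv L V.Hm hV` on elements
(#1097 `toRegime_apply_of`) — since r4 the kernel lemma `finAdelic_mem_archFinOf` of `HodgeCM/Model/ArchSideLevel.lean`, kept
here under its r2 name.  This is theta-3's pin FIELD (L3b) `fin_mem_Gfin` at the honest `S`, for every `k_f` (their
`finTranslate V hV kf = regimeEquiv … (e.symm (1, kf⁻¹))` is the instance `k_f := kf⁻¹`, i.e. `inv_finAdelic_mem_archFinOf`). -/
theorem regimeEquiv_prodSymm_one_mem_archFinOf (hV : IsAnisotropic L V.Hm)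
    (kf : ↥(UnitaryGroup.finAdelic (↥(maximalRealSubfield L)) (L : Type) (IsCMField.complexConj L) 3 V.Hm)) :
    (Adelic.regimeEquiv L V.Hm hV ((UnitaryGroup.cmAdelicProdEquiv (L : Type) 3 V.Hm).symm (1, kf)) :
        (V.latticeModel printFact_unitaryCompact_holds).G) ∈ archFinOf V :=
  finAdelic_mem_archFinOf V hV kf

/-- **`ιinf` in the regime, read back on the tree's arch section**: `archInfOf V u = regimeEquiv L V.Hm hV (s(u))` for the
CM section `s = archSectionU21CM L ι₁ V.Hm V.sylvesterFrame (sylvesterFrame_J V)` of #1097 (`archInfOf_apply`,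
`toLatticeModelG_apply`, `toRegime_apply_of`).  Binder-1's D-1′ frame junction `hι` at the honest `S`. -/
theorem archInfOf_eq_regimeEquiv (hV : IsAnisotropic L V.Hm) (u : U21) :
    archInfOf V u =
      Adelic.regimeEquiv L V.Hm hV
        (UnitaryGroup.archSectionU21CM (L : Type) ι₁ V.Hm V.sylvesterFrame (sylvesterFrame_J V) u) := by
  rw [archInfOf_apply, toLatticeModelG_apply, Adelic.toRegime_apply_of L V.Hm hV]
  rfl

end Fin

/-! ## §S The S pin term -/

section Term

variable (c : SeesawCtx L)
  (hGR : (cmSplittingDatum (L : Type) finProdFinEquiv (frameD V) (frameD_real V) (frameD_ne V) (dW c.D) (dW_real c.D)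
    (dW_ne c.D)).CompatibleSplitting)
  (hGR₀ : (cmSplittingDatum (L : Type) (e₁) (frameD V) (frameD_real V) (frameD_ne V) (lineVec (L : Type) (dW c.D 0))
    (fun _ => dW_real c.D 0) (fun _ => dW_ne c.D 0)).CompatibleSplitting)
  (hGR₁ : (cmSplittingDatum (L : Type) (e₁) (frameD V) (frameD_real V) (frameD_ne V) (lineVec (L : Type) (dW c.D 1))
    (fun _ => dW_real c.D 1) (fun _ => dW_ne c.D 1)).CompatibleSplitting)
  (hGR₂ : (cmSplittingDatum (L : Type) (e₁) (frameD V) (frameD_real V) (frameD_ne V) (lineVec (L : Type) (dW' c.D 0))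
    (fun _ => dW'_real c.D 0) (fun _ => dW'_ne c.D 0)).CompatibleSplitting)
  (hGR₃ : (cmSplittingDatum (L : Type) (e₁) (frameD V) (frameD_real V) (frameD_ne V) (lineVec (L : Type) (dW' c.D 1))
    (fun _ => dW'_real c.D 1) (fun _ => dW'_ne c.D 1)).CompatibleSplitting)
  (η : CMAdelic (L : Type) (frameD V) × CMAdelic (L : Type) (dW c.D) →* ℂˣ)
  (hη : ∀ γU ∈ CMRat (L : Type) (frameD V), ∀ γ ∈ CMRat (L : Type) (dW c.D), η (γU, γ) = 1)
  (hηc : Continuous fun p => ((η p : ℂˣ) : ℂ))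
  (h₁W : (∀ j, 0 < (ι₁ (dW c.D j)).re) ∨ ∀ j, (ι₁ (dW c.D j)).re < 0)
  (A : ∀ k : Fin 4, ArchLineInput V (lineRepD V c.D hGR hGR₀ hGR₁ hGR₂ hGR₃ η k))

/-- **THE S PIN TERM** `archSideOf V c … : ThetaAdelicSide V c` — `(P k).ω := lineRepD k = lineRepOf … k` on the nose,
`(P k).ΓU := (V.latticeModel hP).Γ`, the archimedean component and away-factor of #1097 with their finite-level companions
(L3b) `fin_mem_Gfin` / (L3) `rat_split_level` of `ArchSideLevel`, both Weil hypotheses PROVED (§W); the archimedean test data `A k`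
are input. -/
def archSideOf : ThetaAdelicSide V c where
  P k :=
    { ΓU := (V.latticeModel printFact_unitaryCompact_holds).Γ
      ω := lineRepD V c.D hGR hGR₀ hGR₁ hGR₂ hGR₃ η k
      Φinf := (A k).Φinf
      x₀ := (A k).x₀
      hx₀ := (A k).hx₀
      w := (A k).w
      weight := (A k).weight
      majorants := hasThetaMajorants_lineRepD V c.D hGR hGR₀ hGR₁ hGR₂ hGR₃ η hηc h₁W k
      theta_rat := lineRepD_mem_thetaStabilizerEnd V c.D hGR hGR₀ hGR₁ hGR₂ hGR₃ η hη k }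
  hΓU _ := rfl
  ιinf := archInfOf V
  Gfin := archFinOf V
  comm_fin := commute_archFinOf_archInfOf V
  rat_split := rat_split_archInfOf V
  fin_mem_Gfin := inv_finAdelic_mem_archFinOf V      -- (L3b), `HodgeCM/Model/ArchSideLevel.lean`
  rat_split_level := rat_split_level_archInfOf V     -- (L3),  `HodgeCM/Model/ArchSideLevel.lean` over the tree's `UnitaryGroupAwayLevel`

/-! ### read-backs (all `rfl`): theta-3 HANDOFF §9 `P_eq_restrict` = (J5) -/

/-- (Ported verbatim from the HodgeCMPerL package; no docstring in the source.) -/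
@[simp] theorem archSideOf_P_ω (k : Fin 4) :
    ((archSideOf V c hGR hGR₀ hGR₁ hGR₂ hGR₃ η hη hηc h₁W A).P k).ω =
      lineRepOf V c.D hGR hGR₀ hGR₁ hGR₂ hGR₃ (eta₀ V c.D η) (eta₁ V c.D η) (eta₂ V c.D η) (eta₃ V c.D η) k := rfl

/-- (Ported verbatim from the HodgeCMPerL package; no docstring in the source.) -/
@[simp] theorem archSideOf_P_ΓU (k : Fin 4) :
    ((archSideOf V c hGR hGR₀ hGR₁ hGR₂ hGR₃ η hη hηc h₁W A).P k).ΓU = (V.latticeModel printFact_unitaryCompact_holds).Γ := rfl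

/-- (Ported verbatim from the HodgeCMPerL package; no docstring in the source.) -/
@[simp] theorem archSideOf_P_Φinf (k : Fin 4) :
    ((archSideOf V c hGR hGR₀ hGR₁ hGR₂ hGR₃ η hη hηc h₁W A).P k).Φinf = (A k).Φinf := rfl

/-- (Ported verbatim from the HodgeCMPerL package; no docstring in the source.) -/
@[simp] theorem archSideOf_P_x₀ (k : Fin 4) :
    ((archSideOf V c hGR hGR₀ hGR₁ hGR₂ hGR₃ η hη hηc h₁W A).P k).x₀ = (A k).x₀ := rfl

/-- (Ported verbatim from the HodgeCMPerL package; no docstring in the source.) -/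
@[simp] theorem archSideOf_P_w (k : Fin 4) :
    ((archSideOf V c hGR hGR₀ hGR₁ hGR₂ hGR₃ η hη hηc h₁W A).P k).w = (A k).w := rfl

/-- (Ported verbatim from the HodgeCMPerL package; no docstring in the source.) -/
@[simp] theorem archSideOf_ιinf : (archSideOf V c hGR hGR₀ hGR₁ hGR₂ hGR₃ η hη hηc h₁W A).ιinf = archInfOf V := rfl

/-- (Ported verbatim from the HodgeCMPerL package; no docstring in the source.) -/
@[simp] theorem archSideOf_Gfin : (archSideOf V c hGR hGR₀ hGR₁ hGR₂ hGR₃ η hη hηc h₁W A).Gfin = archFinOf V := rfl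

/-- (L3b) AT THE TERM: `regimeEquiv … (e.symm (1, k_f)) ∈ (archSideOf V c …).Gfin` for every finite-adelic `k_f`. -/
theorem regimeEquiv_prodSymm_one_mem_archSideOf_Gfin (hV : IsAnisotropic L V.Hm)
    (kf : ↥(UnitaryGroup.finAdelic (↥(maximalRealSubfield L)) (L : Type) (IsCMField.complexConj L) 3 V.Hm)) :
    (Adelic.regimeEquiv L V.Hm hV ((UnitaryGroup.cmAdelicProdEquiv (L : Type) 3 V.Hm).symm (1, kf)) :
        (V.latticeModel printFact_unitaryCompact_holds).G) ∈
      (archSideOf V c hGR hGR₀ hGR₁ hGR₂ hGR₃ η hη hηc h₁W A).Gfin :=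
  regimeEquiv_prodSymm_one_mem_archFinOf V hV kf

/-- D-1′ `hι` AT THE TERM: `(archSideOf V c …).ιinf u = regimeEquiv L V.Hm hV (archSectionU21CM L ι₁ V.Hm V.sylvesterFrame _ u)`
(binder-1 `Real34PinJunctions.hι`, verbatim right-hand side). -/
theorem archSideOf_ιinf_apply (hV : IsAnisotropic L V.Hm) (u : U21) :
    (archSideOf V c hGR hGR₀ hGR₁ hGR₂ hGR₃ η hη hηc h₁W A).ιinf u =
      Adelic.regimeEquiv L V.Hm hV
        (UnitaryGroup.archSectionU21CM (L : Type) ι₁ V.Hm V.sylvesterFrame (sylvesterFrame_J V) u) :=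
  archInfOf_eq_regimeEquiv V hV u

/-! ### the binder-1 junctions, SPECIALISED to the term (no η-split hypothesis left) -/

/-- **`op`** of `SeesawCore.ofOp` for the term: LAYER B `op_lineRepOf` with `hη01 := eta_torus01`. -/
theorem op_archSideOf (g : ↥(regimeSubgroup L V.Hm)) (t : SeesawTorus (↥(maximalRealSubfield L)) L)
    (φ₁ φ₂ : piSchwartzBruhat (↥(maximalRealSubfield L)) (Fin 3)) :
    cmPairRepTwist (L : Type) finProdFinEquiv (frameD V) (frameD_real V) (frameD_ne V) (dW c.D) (dW_real c.D) (dW_ne c.D) hGR η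
        ((cmFrameEquiv (L : Type) (frameG V) V.Hm (frameD V) (frame_congr V)) (g : ↥(HodgeCM.Adelic.adelicUnitaryGroup (L : Type) V.Hm)),
          cmAdelicEquiv (L : Type) 2 (Matrix.diagonal (dW c.D)) (c.D.jT₁₂ t)) (tau12 V c.D φ₁ φ₂) =
      tau12 V c.D (((archSideOf V c hGR hGR₀ hGR₁ hGR₂ hGR₃ η hη hηc h₁W A).P 0).ω (g, SeesawTorus.fst _ L t) φ₁)
        (((archSideOf V c hGR hGR₀ hGR₁ hGR₂ hGR₃ η hη hηc h₁W A).P 1).ω (g, SeesawTorus.snd _ L t) φ₂) :=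
  op_lineRepOf V c.D hGR hGR₀ hGR₁ hGR₂ hGR₃ η _ _ _ _ g t (eta_torus01 V c.D η) φ₁ φ₂


-- port_pkg: scope closed for this part
end Term


end ArchSideTerm
end HodgeCM.Model
end
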